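import Mathlib
import Summits.Ventures.PercRepro2.TypedBundleCutRoots
import Summits.Ventures.PercRepro2.K5StarAll

/-!
# The domain of record with the one-star class of degree three subtracted unconditionally (blind
cell PercRepro2, p2 g3, 2026-08-25)

`ResidualCoreNHatCTBS` = the hat landing without a root cut, a two-terminal part, a root bundle or
a one-star of degree three; **`HCov_all_of_residualCoreNHatCTBS_all`** is UNCONDITIONAL on the
landed certificate bundle `K5.starCerts_holds` (the 66 `decide +kernel` certificates of
K5StarCert*). The general star stays the named hypothesis `StarCertsGen R` (`…FullTB_all`).
-/

namespace Summit.Ventures.PercRepro2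

open UnionCluster

namespace CovForm

namespace TypedRed

section Core

variable {V : Type*} {E : Type*} [DecidableEq V] [Fintype E] [DecidableEq E]

/-- **The domain of record without a one-star of degree three.** -/
structure ResidualCoreNHatCTBS (ends : E → Sym2 V) (o a₁ a₂ a₃ b : V) (F : Finset E) : Prop where
  coreNHatCTB : ResidualCoreNHatCTB ends o a₁ a₂ a₃ b F
  not_oneStar : ¬ OneStar ends o a₁ a₂ a₃ b F

end Core

section Closure

variable (R : Type*) [Field R] [LinearOrder R] [IsStrictOrderedRing R]

/-- **Row 2′TRI on `ResidualCoreNHatCTBS`, over every finite graph.** -/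
def ResidualCoreNHatCTBS_all : Prop :=
  ∀ (V E : Type) [Fintype V] [DecidableEq V] [Fintype E] [DecidableEq E]
    (ends : E → Sym2 V) (o a₁ a₂ a₃ b : V) (F : Finset E) (τ : E → ℕ),
    (∀ e ∈ F, τ e = 1 ∨ τ e = 2) → ResidualCoreNHatCTBS ends o a₁ a₂ a₃ b F →
      0 ≤ typedCount F (fun _ => false) τ
        (K3 ends o a₁ a₂ a₃ b : Config E → Config E → Config E → R)

/-- **THE CRUX OF RECORD FROM (TRI) ON THE DOMAIN OF RECORD WITHOUT ONE-STARS OF DEGREE THREE** —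
unconditional, on the landed certificate bundle. -/
theorem HCov_all_of_residualCoreNHatCTBS_all (hc : ResidualCoreNHatCTBS_all R) : HCov_all R := by
  refine HCov_all_of_residualCoreNHatCTB_all R ?_
  intro V E _ _ _ _ ends o a₁ a₂ a₃ b F τ hτ hcore
  have hred := hcore.coreNHatC.coreNHat.core.residualConR.residualCon.residual.reduced
  by_cases hs : OneStar ends o a₁ a₂ a₃ b F
  · exact typedCount_nonneg_of_oneStar (K5.starCerts_holds R) ends o a₁ a₂ a₃ b F τ hτ
      hcore.coreNHatC.coreNHat.core.marks hred.no_loop hred.no_parallel hs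
  · exact hc V E ends o a₁ a₂ a₃ b F τ hτ ⟨hcore, hs⟩

end Closure

end TypedRed

end CovForm

end Summit.Ventures.PercRepro2
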